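import Mathlib
import HarnessLib
import Summits.Ventures.LatticeQCDFlow.Exactness.SphereGeodesicExponential
import Summits.Ventures.LatticeQCDFlow.Exactness.SphereDriftLift

/-!
# The ambient sphere drift of `cpn_2d` is `(e^{τA}x, e^{τA}p)` for EVERY ambient momentum, and rotating the frame conjugates the rotation: `e^{τA(Wx,Wp)} W = W e^{τA(x,p)}`

HONEST FRAMING: exact (Metropolis-corrected) sampling algorithms for lattice gauge theory;
figures of merit are autocorrelation/cost numbers at stated couplings and volumes; no
continuum-physics claim.

Venture `LatticeQCDFlow` (cell pub-lqcd), topic `Exactness`, FANOUT row 9 (eng-latcore, the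
engine `latflow.core.cpn_2d.HMCCPN`: AMBIENT site momenta `π = g − Re(z†g) z`, exact geodesic site
update).  NEW WORK of the cell over the tree (`SphereGeodesicExponential.lean`: the generator `geodGen x π`
and `geodesicDrift τ (x, π) = (e^{τA}x, e^{τA}π)` for tangent `π`; row 7's `SphereDriftLift.lean`:
`ambientDrift`, `tangentialPart`) and Mathlib (`hasDerivAt_exp_smul_const'`, `HasDerivAt.clm_apply`,
`is_const_of_deriv_eq_zero`); nothing is cited as a fact; no number.

THE POINT (the second brick of the body-frame reduction of the sphere leapfrog to the kicked-product
systems of `KickedProductTrajectory.lean`; design in HOME/eng-latcore/HANDOFF.md GEN-19):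

* §1 `geodGen_sub_smul_self` — `A(x, p − c x) = A(x, p)`: the generator only sees the tangential part
  of the momentum, so NO projection is needed in the operator picture;
  **`ambientDrift_eq_exp`** — row 7's ambient drift (geodesic step of the tangential part, normal
  component carried along) is `(e^{τA}x, e^{τA}p)` with `A = A(x, p)`, for EVERY `p ∈ ℝ^m`
  (`coe_fst_ambientDrift_eq_exp`, `snd_ambientDrift_eq_exp`).
* §2 **`exp_geodGen_conj`** — for a linear isometry equivalence `W` and all `x, p, y`:
  `e^{τA(Wx, Wp)} (W y) = W (e^{τA(x,p)} y)` (`A(Wx,Wp)∘W = W∘A(x,p)` and the same ODE-constancy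
  argument as in the previous file — no series, no `exp (W A W⁻¹)` algebra); hence in the BODY FRAME
  `x = W e`, `p = W q` the drift is `W ← W ∘ e^{τA(e,q)}`, `q` unchanged: `ambientDrift_frame`.

NOT CLAIMED: the kick in the body frame and the `n`-step recursion (next brick); matrices / `SO(m)`
(`bodyRot t e q = e^{tA}` as a matrix identity); families of spheres; anything quantitative.
-/

noncomputable section

namespace Summit.Ventures.LatticeQCDFlow.Exactness

open Real NormedSpace Metric
open scoped InnerProductSpace

/-! ## §1 The ambient drift -/

section Ambient

variable {V : Type*} [NormedAddCommGroup V] [InnerProductSpace ℝ V]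

/-- **The generator only sees the tangential momentum**: `A(x, p − c x) = A(x, p)`. -/
theorem geodGen_sub_smul_self (x p : V) (c : ℝ) : geodGen x (p - c • x) = geodGen x p := by
  ext y
  simp only [geodGen_apply, inner_sub_left, real_inner_smul_left, sub_smul, smul_sub, smul_smul]
  module

variable {m : Type*} [Fintype m]

/-- The position component of the ambient drift: `x' = e^{τA(x,p)} x` for EVERY ambient `p`. -/
theorem coe_fst_ambientDrift_eq_exp (t : ℝ) (z : (sphere (0 : EuclideanSpace ℝ m) 1) × (EuclideanSpace ℝ m)) :
    ((ambientDrift t z).1 : EuclideanSpace ℝ m) =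
      exp (t • geodGen (z.1 : EuclideanSpace ℝ m) z.2) (z.1 : EuclideanSpace ℝ m) := by
  have hx : ‖(z.1 : EuclideanSpace ℝ m)‖ = 1 := norm_eq_of_mem_sphere z.1
  have h := geodesicDrift_fst_eq_exp hx (inner_tangentialPart z) t
  rw [show tangentialPart z = z.2 - ⟪(z.1 : EuclideanSpace ℝ m), z.2⟫_ℝ • (z.1 : EuclideanSpace ℝ m) from rfl,
    geodGen_sub_smul_self] at h
  exact h

/-- The momentum component of the ambient drift: `p' = e^{τA(x,p)} p` for EVERY ambient `p` (the
tangential part rotates, the normal component `⟪x, p⟫` rides on `x' = e^{τA}x`, and `e^{τA}` is linear). -/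
theorem snd_ambientDrift_eq_exp (t : ℝ) (z : (sphere (0 : EuclideanSpace ℝ m) 1) × (EuclideanSpace ℝ m)) :
    (ambientDrift t z).2 = exp (t • geodGen (z.1 : EuclideanSpace ℝ m) z.2) z.2 := by
  have hx : ‖(z.1 : EuclideanSpace ℝ m)‖ = 1 := norm_eq_of_mem_sphere z.1
  have h1 := geodesicDrift_fst_eq_exp hx (inner_tangentialPart z) t
  have h2 := geodesicDrift_snd_eq_exp hx (inner_tangentialPart z) t
  have ht : tangentialPart z = z.2 - ⟪(z.1 : EuclideanSpace ℝ m), z.2⟫_ℝ • (z.1 : EuclideanSpace ℝ m) := rfl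
  rw [ht, geodGen_sub_smul_self] at h1 h2
  change (geodesicDrift t ((z.1 : EuclideanSpace ℝ m), tangentialPart z)).2 +
      ⟪(z.1 : EuclideanSpace ℝ m), z.2⟫_ℝ • (geodesicDrift t ((z.1 : EuclideanSpace ℝ m), tangentialPart z)).1 = _
  rw [ht, h1, h2, ← map_smul, ← map_add, sub_add_cancel]

/-- **THE AMBIENT DRIFT IS THE EXPONENTIAL OF THE GENERATOR**: `ambientDrift τ (x, p) = (e^{τA}x, e^{τA}p)`,
`A = A(x, p)`, for every point of the sphere and EVERY ambient momentum. -/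
theorem ambientDrift_eq_exp (t : ℝ) (z : (sphere (0 : EuclideanSpace ℝ m) 1) × (EuclideanSpace ℝ m)) :
    ambientDrift t z =
      (⟨exp (t • geodGen (z.1 : EuclideanSpace ℝ m) z.2) (z.1 : EuclideanSpace ℝ m), by
          rw [← coe_fst_ambientDrift_eq_exp]; exact (ambientDrift t z).1.2⟩,
        exp (t • geodGen (z.1 : EuclideanSpace ℝ m) z.2) z.2) :=
  Prod.ext (Subtype.ext (coe_fst_ambientDrift_eq_exp t z)) (snd_ambientDrift_eq_exp t z)

end Ambient

/-! ## §2 Rotating the frame conjugates the rotation -/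

section Frame

variable {V : Type*} [NormedAddCommGroup V] [InnerProductSpace ℝ V]

/-- `A(Wx, Wp) (W y) = W (A(x, p) y)` for a linear isometry equivalence `W`. -/
theorem geodGen_isometry_apply (W : V ≃ₗᵢ[ℝ] V) (x p y : V) :
    geodGen (W x) (W p) (W y) = W (geodGen x p y) := by
  simp only [geodGen_apply, LinearIsometryEquiv.inner_map_map, map_sub, map_smul]

variable [CompleteSpace V]

/-- **`e^{τA(Wx,Wp)} (W y) = W (e^{τA(x,p)} y)`** for a linear isometry equivalence `W` and all `x, p, y`
(`u(s) = e^{(τ−s)A(Wx,Wp)} W e^{sA(x,p)} y` has zero derivative). -/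
theorem exp_geodGen_conj (W : V ≃ₗᵢ[ℝ] V) (x p y : V) (t : ℝ) :
    exp (t • geodGen (W x) (W p)) (W y) = W (exp (t • geodGen x p) y) := by
  set A := geodGen x p with hA
  set B := geodGen (W x) (W p) with hB
  have hcommB : ∀ r : ℝ, B * exp (r • B) = exp (r • B) * B := fun r =>
    (((Commute.refl B).smul_right r).exp_right).eq
  -- `u(s) = e^{(t-s)B} W e^{sA} y` has zero derivative
  have hu : ∀ s, HasDerivAt (fun r : ℝ => exp ((t - r) • B) (W (exp (r • A) y))) 0 s := by
    intro s
    have h1 : HasDerivAt (fun r : ℝ => t - r) (-1) s := by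
      simpa using (hasDerivAt_id s).const_sub t
    have hE : HasDerivAt (fun r : ℝ => exp ((t - r) • B)) ((-1 : ℝ) • (B * exp ((t - s) • B))) s :=
      (hasDerivAt_exp_smul_const' (𝕂 := ℝ) B (t - s)).scomp s h1
    have hin : HasDerivAt (fun r : ℝ => W (exp (r • A) y)) (W ((A * exp (s • A)) y)) s := by
      have h := ((hasDerivAt_exp_smul_const' (𝕂 := ℝ) A s).clm_apply (hasDerivAt_const s y))
      have h' : HasDerivAt (fun r : ℝ => exp (r • A) y) ((A * exp (s • A)) y) s := h.congr_deriv (by simp)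
      exact (W.toContinuousLinearEquiv : V →L[ℝ] V).hasFDerivAt.comp_hasDerivAt s h'
    have h := hE.clm_apply hin
    refine h.congr_deriv ?_
    rw [neg_one_smul]
    have key : (exp ((t - s) • B)) (W ((A * exp (s • A)) y)) = (B * exp ((t - s) • B)) (W (exp (s • A) y)) := by
      rw [hcommB]
      show (exp ((t - s) • B)) (W (A (exp (s • A) y))) = (exp ((t - s) • B)) (B (W (exp (s • A) y)))
      rw [hB, geodGen_isometry_apply, ← hA]
    rw [key]
    exact neg_add_cancel _
  have hconst := is_const_of_deriv_eq_zero (f := fun r : ℝ => exp ((t - r) • B) (W (exp (r • A) y)))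
    (fun s => (hu s).differentiableAt) (fun s => (hu s).deriv) t 0
  simp only [sub_self, sub_zero, zero_smul, NormedSpace.exp_zero, one_apply_eq_self] at hconst
  exact hconst.symm

variable {m : Type*} [Fintype m]

/-- **The drift in the body frame.**  If `x = W e` and `p = W q` for a linear isometry equivalence `W` of
`ℝ^m`, then `ambientDrift τ (x, p) = (W (e^{τA(e,q)} e), W (e^{τA(e,q)} q))`: the frame becomes
`W ∘ e^{τA(e,q)}` and the body momentum `q` is unchanged. -/
theorem ambientDrift_frame (t : ℝ) (W : EuclideanSpace ℝ m ≃ₗᵢ[ℝ] EuclideanSpace ℝ m)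
    (e : sphere (0 : EuclideanSpace ℝ m) 1) (q : EuclideanSpace ℝ m)
    (x : sphere (0 : EuclideanSpace ℝ m) 1) (hx : (x : EuclideanSpace ℝ m) = W (e : EuclideanSpace ℝ m)) :
    ((ambientDrift t (x, W q)).1 : EuclideanSpace ℝ m) = W (exp (t • geodGen (e : EuclideanSpace ℝ m) q) (e : EuclideanSpace ℝ m)) ∧
      (ambientDrift t (x, W q)).2 = W (exp (t • geodGen (e : EuclideanSpace ℝ m) q) q) := by
  refine ⟨?_, ?_⟩
  · rw [coe_fst_ambientDrift_eq_exp]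
    simp only [hx]
    exact exp_geodGen_conj W _ _ _ t
  · rw [snd_ambientDrift_eq_exp]
    simp only [hx]
    exact exp_geodGen_conj W _ _ _ t

end Frame

end Summit.Ventures.LatticeQCDFlow.Exactness
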